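/-
Copyright (c) 2026 the pub-hodgecm-mathlib formalisation cell (harness21).  Prover seat hodgecm-mathlib-K2Liu-p08 (g4), Track B «K2-LIT» ∕ hLiu418
#184♮, socket #42S organ S1 (ROAD W), brick F8 (T3-frame (iii-c)-split: the split frame and the six-block regrouping) (LEAD F0P6-plan (g14) BATCH #6 (4), #8 (4);
K2Liu-p01 (g8) κ-COMPOSITION SPEC 12:32:42Z).  2026-09-04.  KERNEL: theorems only.
-/
import Summits.HodgeConjecture.HodgeConjecture.Theorems.K2LiuLocalRingSplitReading      -- ★ p860045: `reading_injective∕surjective`, `reading_conjLocal`, `conjLocal_conjLocal`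
import Mathlib.LinearAlgebra.Matrix.NonsingularInverse
import Mathlib.LinearAlgebra.Matrix.Notation
import HarnessLib

/-!
# Crux `HLiu418`, #42S-S1 ROAD W, brick (T3-frame (iii-c)-split): THE HYPERBOLIC FRAME EXISTS AT A SPLIT PLACE, AND THE SIX-BLOCK REGROUPING

Cell `hodgecm-mathlib`, crux item hLiu418 = `stmt-HodgeConjecture-24832` (helper lane `--supports … --as helper`, count-neutral).  THEOREMS ONLY (no `def`, no instance,
no notation, no named-fact hypothesis, no `sorry`).  The two split-specific inputs of ★∕📤 (iii-c) `K2LiuWitnessFrameCoordinate.exists_frame_addEquiv` (p860223) at a place `v`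
SPLIT in `E∕F` (`w₀` with `c • w₀ ≠ w₀`; `R = LocalRing E v = E ⊗ F_v`, `σ = conjLocal`, `K = E_{w₀}`, reading `z ↦ (z(w₀), (σz)(w₀))` of ★ p860045):
* §1 reading bookkeeping: `isUnit_of_reading` ∕ **`isUnit_iff_reading`** (`z` is a unit iff both readings are), **`matrix_eq_of_reading`** (a matrix identity over `R` holds iff it holds after
  `z ↦ z(w₀)` and after `z ↦ (σz)(w₀)`), `map_eval_mul`, `map_hyperbolic` (entrywise images of `[[0,1,0],[1,0,0],[0,0,d]]`);
* §2 ★★ **`exists_split_frame`**: for a Gram `D ∈ M₃(R)` with `σ(D) = D`, `Dᵀ = D`, `det D` a unit (the diagonal `gramS(realDiagonal dV′)`) and ANY `σ`-fixed unit `d` (at a split place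
  EVERY such `d` is attained — take `d = 1`, so `v(d) = 0` in ★ F7c-S3), there is a frame matrix `P` with `IsUnit P.det` and `P·Dᵀ·σ(P)ᵀ = [[0,1,0],[1,0,0],[0,0,d]]` — read at `w₀`:
  `P ↦ (M₀·D₀⁻¹, 1)`; no norm condition, no parity (contrast ★ (ii-a) at inert places);
* §3 **`exists_split_regroup`**: the additive equivalence `((Fin 2 → R))³ ≃+ ((Fin 2 → K))⁶`, `(A, B, C) ↦ (B″, B′, A′, A″, C′, C″)` (`X′ j = X j (w₀)`, `X″ j = (σ (X j))(w₀)`) — the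
  currency of ★ (T3-core-split) ∕ ★ (iii-b)-split p860147; with ★ `reading_gram_fst∕snd` the Gram of `(A,B,C)` reads `(K, Kᵀ)`, `K = A′B″ᵀ + B′A″ᵀ + d′C′C″ᵀ`.
[Shimura1997, §13.2] [Scharlau1985HermitianForms, Ch. 7 §1] [CasselsFrohlichANT1967, Ch. II §10].
HONEST LABEL.  Count-neutral helper; `HC_CM` is proved only modulo the 7 printed citations (2 remaining named inputs: hLiu418 = `stmt-HodgeConjecture-24832`,
h413 = `stmt-HodgeConjecture-24833`) until rung 0 closes.

## References
* [Shimura1997] G. Shimura, CBMS 93 (1997), §13.2.   * [Scharlau1985HermitianForms] W. Scharlau, Grundlehren 270 (1985), Ch. 7 §1.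
* [CasselsFrohlichANT1967] J. W. S. Cassels, A. Fröhlich (eds.), *Algebraic Number Theory* (1967), Ch. II §10.
-/

set_option autoImplicit false
set_option linter.dupNamespace false -- the mandated namespace repeats `HodgeConjecture.HodgeConjecture`

open Matrix
open Literature.NumberTheory.Automorphic Literature.NumberTheory.Automorphic.UnitaryGroup

namespace Summit.HodgeConjecture.HodgeConjecture.Cruxes.HLiu418.K2LiuWitnessFrameCoordinateSplit

open K2LiuLocalRingSplitReading

variable {F E : Type} [Field F] [NumberField F] [Field E] [NumberField E] [Algebra F E] [Algebra.IsQuadraticExtension F E]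
  (c : E ≃ₐ[F] E) {δ : E} (hcδ : c δ = -δ) (hδ : δ ≠ 0) (v : IsDedekindDomain.HeightOneSpectrum (NumberField.RingOfIntegers F))
  (w₀ : PlacesOver E v) (hw₀ : c • w₀.1 ≠ w₀.1)

/-! ## §1 Reading bookkeeping: units and matrix identities -/

include hcδ hδ hw₀ in
/-- **a point of `E ⊗ F_v` is a unit iff both readings are units**. [cite: CasselsFrohlichANT1967, Ch. II §10] -/
theorem isUnit_iff_reading (z : LocalRing E v) : IsUnit z ↔ IsUnit (z w₀) ∧ IsUnit (conjLocal E c v z w₀) := by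
  constructor
  · intro h
    exact ⟨h.map (Pi.evalRingHom (fun w : PlacesOver E v => w.1.adicCompletion E) w₀),
      (h.map (conjLocal E c v)).map (Pi.evalRingHom (fun w : PlacesOver E v => w.1.adicCompletion E) w₀)⟩
  · rintro ⟨h1, h2⟩
    obtain ⟨y, hy⟩ := reading_surjective c hcδ hδ v w₀ hw₀ ((z w₀)⁻¹, (conjLocal E c v z w₀)⁻¹)
    have hy1 : y w₀ = (z w₀)⁻¹ := congrArg Prod.fst hy
    have hy2 : conjLocal E c v y w₀ = (conjLocal E c v z w₀)⁻¹ := congrArg Prod.snd hy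
    refine isUnit_iff_exists_inv.2 ⟨y, reading_injective c v w₀ hw₀ (Prod.ext ?_ ?_)⟩
    · show (z * y) w₀ = (1 : LocalRing E v) w₀
      rw [Pi.mul_apply, hy1, Pi.one_apply, mul_inv_cancel₀ h1.ne_zero]
    · show conjLocal E c v (z * y) w₀ = conjLocal E c v 1 w₀
      rw [map_mul, map_one, Pi.mul_apply, hy2, Pi.one_apply, mul_inv_cancel₀ h2.ne_zero]

include hw₀ in
/-- **a matrix identity over `E ⊗ F_v` holds iff it holds after both readings**. [cite: CasselsFrohlichANT1967, Ch. II §10] -/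
theorem matrix_eq_of_reading {m n : Type*} (X Y : Matrix m n (LocalRing E v))
    (h1 : X.map (Pi.evalRingHom (fun w : PlacesOver E v => w.1.adicCompletion E) w₀) = Y.map (Pi.evalRingHom (fun w : PlacesOver E v => w.1.adicCompletion E) w₀))
    (h2 : X.map ((Pi.evalRingHom (fun w : PlacesOver E v => w.1.adicCompletion E) w₀).comp (conjLocal E c v)) =
      Y.map ((Pi.evalRingHom (fun w : PlacesOver E v => w.1.adicCompletion E) w₀).comp (conjLocal E c v))) : X = Y := by
  exact Matrix.ext fun i j => reading_injective c v w₀ hw₀ (Prod.ext (congrFun (congrFun h1 i) j) (congrFun (congrFun h2 i) j))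

omit [NumberField F] [Algebra.IsQuadraticExtension F E] in
/-- entrywise image of the hyperbolic Gram under a ring homomorphism. [folklore] -/
theorem map_hyperbolic {S T : Type*} [CommRing S] [CommRing T] (f : S →+* T) (d : S) :
    (!![0, 1, 0; 1, 0, 0; 0, 0, d] : Matrix (Fin 3) (Fin 3) S).map f = !![0, 1, 0; 1, 0, 0; 0, 0, f d] := by
  ext i j
  fin_cases i <;> fin_cases j <;> simp

omit [NumberField F] [Algebra.IsQuadraticExtension F E] in
/-- the hyperbolic Gram is symmetric. [folklore] -/
theorem hyperbolic_transpose {S : Type*} [CommRing S] (d : S) : (!![0, 1, 0; 1, 0, 0; 0, 0, d] : Matrix (Fin 3) (Fin 3) S)ᵀ = !![0, 1, 0; 1, 0, 0; 0, 0, d] := by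
  ext i j
  fin_cases i <;> fin_cases j <;> simp

omit [NumberField F] [Algebra.IsQuadraticExtension F E] in
/-- `det [[0,1,0],[1,0,0],[0,0,d]] = −d`. [folklore] -/
theorem det_hyperbolic {S : Type*} [CommRing S] (d : S) : (!![0, 1, 0; 1, 0, 0; 0, 0, d] : Matrix (Fin 3) (Fin 3) S).det = -d := by
  rw [det_fin_three]
  simp

/-! ## §2 The hyperbolic frame at a split place -/

include hcδ hδ hw₀ in
/-- **THE HYPERBOLIC FRAME EXISTS AT A SPLIT PLACE, for every `σ`-fixed unit `d`.**  For `D ∈ M₃(E ⊗ F_v)` with `σ(D) = D`, `Dᵀ = D`, `det D` a unit, and `d` with `σ d = d`,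
`d` a unit: `∃ P, IsUnit P.det ∧ P·Dᵀ·σ(P)ᵀ = [[0,1,0],[1,0,0],[0,0,d]]` (read at `w₀`: `P′ = M₀·D₀⁻¹`, `P″ = 1`). [cite: Scharlau1985HermitianForms, Ch. 7 §1] [cite: Shimura1997, §13.2] -/
theorem exists_split_frame {D : Matrix (Fin 3) (Fin 3) (LocalRing E v)} (hD : D.map (conjLocal E c v) = D) (hDt : Dᵀ = D) (hDu : IsUnit D.det)
    {d : LocalRing E v} (hd : conjLocal E c v d = d) (hdu : IsUnit d) :
    ∃ P : Matrix (Fin 3) (Fin 3) (LocalRing E v), IsUnit P.det ∧ P * Dᵀ * (P.map (conjLocal E c v))ᵀ = !![0, 1, 0; 1, 0, 0; 0, 0, d] := by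
  classical
  -- the two readings as ring homomorphisms
  set π₁ : LocalRing E v →+* (w₀.1).adicCompletion E := Pi.evalRingHom (fun w : PlacesOver E v => w.1.adicCompletion E) w₀ with hπ₁
  set π₂ : LocalRing E v →+* (w₀.1).adicCompletion E := π₁.comp (conjLocal E c v) with hπ₂
  have hπ₁a : ∀ z, π₁ z = z w₀ := fun z => rfl
  have hπ₂a : ∀ z, π₂ z = conjLocal E c v z w₀ := fun z => rfl
  have hπ₂σ : ∀ z, π₂ (conjLocal E c v z) = π₁ z := fun z => by rw [hπ₂a, conjLocal_conjLocal c v hcδ hδ, hπ₁a]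
  -- the read Gram `D₀` and target `M₀`
  set D₀ : Matrix (Fin 3) (Fin 3) ((w₀.1).adicCompletion E) := D.map π₁ with hD₀
  have hD₀' : D.map π₂ = D₀ := by
    rw [hD₀]
    conv_rhs => rw [← hD]
    rw [Matrix.map_map]
    rfl
  have hD₀t : D₀ᵀ = D₀ := by rw [hD₀, ← transpose_map, hDt]
  have hD₀u : IsUnit D₀.det := by
    have h := hDu.map π₁
    rw [RingHom.map_det] at h
    exact h
  set M₀ : Matrix (Fin 3) (Fin 3) ((w₀.1).adicCompletion E) := !![0, 1, 0; 1, 0, 0; 0, 0, π₁ d] with hM₀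
  -- the frame, read: `P′ = M₀ D₀⁻¹`, `P″ = 1`; lift entrywise through the reading
  set P' : Matrix (Fin 3) (Fin 3) ((w₀.1).adicCompletion E) := M₀ * D₀⁻¹ with hP'
  have hex : ∀ r s : Fin 3, ∃ z : LocalRing E v, z w₀ = P' r s ∧ conjLocal E c v z w₀ = (1 : Matrix (Fin 3) (Fin 3) ((w₀.1).adicCompletion E)) r s := by
    intro r s
    obtain ⟨z, hz⟩ := reading_surjective c hcδ hδ v w₀ hw₀ (P' r s, (1 : Matrix (Fin 3) (Fin 3) ((w₀.1).adicCompletion E)) r s)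
    exact ⟨z, congrArg Prod.fst hz, congrArg Prod.snd hz⟩
  choose Pf hPf using hex
  refine ⟨of Pf, ?_, ?_⟩
  · -- determinant: read `(det P′, det 1)`, both units
    have h1 : (of Pf : Matrix (Fin 3) (Fin 3) (LocalRing E v)).map π₁ = P' := Matrix.ext fun r s => (hPf r s).1
    have h2 : (of Pf : Matrix (Fin 3) (Fin 3) (LocalRing E v)).map π₂ = 1 := Matrix.ext fun r s => (hPf r s).2
    refine (isUnit_iff_reading c hcδ hδ v w₀ hw₀ _).2 ⟨?_, ?_⟩
    · show IsUnit (π₁ (of Pf : Matrix (Fin 3) (Fin 3) (LocalRing E v)).det)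
      rw [RingHom.map_det, RingHom.mapMatrix_apply, h1, hP', det_mul, hM₀, det_hyperbolic]
      exact (hdu.map π₁).neg.mul (isUnit_nonsing_inv_det D₀ hD₀u)
    · show IsUnit (π₂ (of Pf : Matrix (Fin 3) (Fin 3) (LocalRing E v)).det)
      rw [RingHom.map_det, RingHom.mapMatrix_apply, h2, det_one]
      exact isUnit_one
  · -- the frame relation, read at both places
    have h1 : (of Pf : Matrix (Fin 3) (Fin 3) (LocalRing E v)).map π₁ = P' := Matrix.ext fun r s => (hPf r s).1
    have h2 : (of Pf : Matrix (Fin 3) (Fin 3) (LocalRing E v)).map π₂ = 1 := Matrix.ext fun r s => (hPf r s).2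
    have hπd : π₂ d = π₁ d := by rw [hπ₂a, hd, hπ₁a]
    have hσ1 : ((of Pf : Matrix (Fin 3) (Fin 3) (LocalRing E v)).map (conjLocal E c v)).map π₁ = 1 := by
      rw [Matrix.map_map]; exact h2
    have hσ2 : ((of Pf : Matrix (Fin 3) (Fin 3) (LocalRing E v)).map (conjLocal E c v)).map π₂ = P' := by
      rw [Matrix.map_map, ← h1]
      exact congrArg _ (funext hπ₂σ)
    refine matrix_eq_of_reading c v w₀ hw₀ _ _ ?_ ?_
    · -- at `w₀`: `P′ · D₀ · 1 = M₀`
      rw [Matrix.map_mul, Matrix.map_mul, transpose_map, transpose_map, hσ1, transpose_one, Matrix.mul_one, ← hD₀, hD₀t, h1, hP', Matrix.mul_assoc,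
        nonsing_inv_mul D₀ hD₀u, Matrix.mul_one, map_hyperbolic, hM₀]
    · -- at `w̄₀`: `1 · D₀ · P′ᵀ = D₀ D₀⁻¹ M₀ = M₀`
      rw [Matrix.map_mul, Matrix.map_mul, transpose_map, transpose_map, hσ2, h2, Matrix.one_mul, hD₀', hD₀t, hP', transpose_mul, transpose_nonsing_inv, hD₀t,
        hM₀, hyperbolic_transpose, ← Matrix.mul_assoc, mul_nonsing_inv D₀ hD₀u, Matrix.one_mul, map_hyperbolic, hπd]

/-! ## §3 The six-block regrouping `(A, B, C) ↦ (B″, B′, A′, A″, C′, C″)` -/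

include hcδ hδ hw₀ in
/-- **THE SIX-BLOCK REGROUPING**: `((Fin 2 → R))³ ≃+ ((Fin 2 → K))⁶`, `(A,B,C) ↦ (B″,B′,A′,A″,C′,C″)` with `X′ j = X j (w₀)`, `X″ j = (σ (X j))(w₀)` (bijective by ★ reading).
[cite: CasselsFrohlichANT1967, Ch. II §10] [cite: Shimura1997, §13.2] -/
theorem exists_split_regroup :
    ∃ θ : ((Fin 2 → LocalRing E v) × (Fin 2 → LocalRing E v) × (Fin 2 → LocalRing E v)) ≃+
        ((Fin 2 → (w₀.1).adicCompletion E) × (Fin 2 → (w₀.1).adicCompletion E) × (Fin 2 → (w₀.1).adicCompletion E) ×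
          (Fin 2 → (w₀.1).adicCompletion E) × (Fin 2 → (w₀.1).adicCompletion E) × (Fin 2 → (w₀.1).adicCompletion E)),
      ∀ t, θ t = (fun j => conjLocal E c v (t.2.1 j) w₀, fun j => t.2.1 j w₀, fun j => t.1 j w₀, fun j => conjLocal E c v (t.1 j) w₀,
        fun j => t.2.2 j w₀, fun j => conjLocal E c v (t.2.2 j) w₀) := by
  classical
  -- the additive map
  let θ₀ : ((Fin 2 → LocalRing E v) × (Fin 2 → LocalRing E v) × (Fin 2 → LocalRing E v)) →+
      ((Fin 2 → (w₀.1).adicCompletion E) × (Fin 2 → (w₀.1).adicCompletion E) × (Fin 2 → (w₀.1).adicCompletion E) ×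
        (Fin 2 → (w₀.1).adicCompletion E) × (Fin 2 → (w₀.1).adicCompletion E) × (Fin 2 → (w₀.1).adicCompletion E)) :=
    { toFun := fun t => (fun j => conjLocal E c v (t.2.1 j) w₀, fun j => t.2.1 j w₀, fun j => t.1 j w₀, fun j => conjLocal E c v (t.1 j) w₀,
        fun j => t.2.2 j w₀, fun j => conjLocal E c v (t.2.2 j) w₀)
      map_zero' := by simp only [Prod.fst_zero, Prod.snd_zero, Pi.zero_apply, map_zero]; rfl
      map_add' := fun s t => by simp only [Prod.fst_add, Prod.snd_add, Pi.add_apply, map_add]; rfl }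
  have hinj : Function.Injective θ₀ := by
    intro s t h
    simp only [θ₀, AddMonoidHom.coe_mk, ZeroHom.coe_mk, Prod.mk.injEq] at h
    obtain ⟨hB2, hB1, hA1, hA2, hC1, hC2⟩ := h
    have key : ∀ (X Y : Fin 2 → LocalRing E v), (fun j => X j w₀) = (fun j => Y j w₀) → (fun j => conjLocal E c v (X j) w₀) = (fun j => conjLocal E c v (Y j) w₀) → X = Y :=
      fun X Y h1 h2 => funext fun j => reading_injective c v w₀ hw₀ (Prod.ext (congrFun h1 j) (congrFun h2 j))
    exact Prod.ext (key _ _ hA1 hA2) (Prod.ext (key _ _ hB1 hB2) (key _ _ hC1 hC2))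
  have hsurj : Function.Surjective θ₀ := by
    rintro ⟨B2, B1, A1, A2, C1, C2⟩
    have hex : ∀ (X1 X2 : Fin 2 → (w₀.1).adicCompletion E), ∃ X : Fin 2 → LocalRing E v, (fun j => X j w₀) = X1 ∧ (fun j => conjLocal E c v (X j) w₀) = X2 := by
      intro X1 X2
      choose X hX using fun j => reading_surjective c hcδ hδ v w₀ hw₀ (X1 j, X2 j)
      exact ⟨X, funext fun j => congrArg Prod.fst (hX j), funext fun j => congrArg Prod.snd (hX j)⟩
    obtain ⟨A, hA1, hA2⟩ := hex A1 A2
    obtain ⟨B, hB1, hB2⟩ := hex B1 B2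
    obtain ⟨C, hC1, hC2⟩ := hex C1 C2
    exact ⟨(A, B, C), by simp only [θ₀, AddMonoidHom.coe_mk, ZeroHom.coe_mk, hA1, hA2, hB1, hB2, hC1, hC2]⟩
  exact ⟨AddEquiv.ofBijective θ₀ ⟨hinj, hsurj⟩, fun t => rfl⟩

end Summit.HodgeConjecture.HodgeConjecture.Cruxes.HLiu418.K2LiuWitnessFrameCoordinateSplit
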